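import Summits.QuantumFields.BalabanUV.T4Continuum.Support.NE9FadingArithmetic
import Summits.QuantumFields.BalabanUV.T4Continuum.Support.NE9MarginalProjection

/-!
# NE9FadingArithmeticRider — leaf N2 RIDER (crew item (w10) of row NE9): the marginal-projection factor `1 + c`, `c = cr·a`,
# of the corrected rate letter `ω′ = ω + 8·lipbar·B·(1 + cr·a)·τ̄` folded into the threshold / monotonicity lemmas of
# `NE9FadingArithmetic` ((w6)); printed-letters corollaries; the FLOOR `cr·a ≥ 1`; junction BY NAME with the owner's anchors
# (cell `pub-balaban`, `HOME/BINDER-OWNERS.md` row NE9; owner's CLAIM TABLE RESTATED 2026-08-20 «(w10) N2 RIDER»; skeleton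
# `t4/b2b-balaban-t4-ne9-p1/SKELETON-NE9-P1.md` v1.3.1 §3 rows N2 / RO / AW; unit `b2b-balaban-t4-ne9-formalise-leaf-07-g2`)

HONEST FRAMING (T4-DAG PAGE 1).  The cell's T⁴ target is rung (B)+1: existence AND uniqueness of the ε → 0 limit of
gauge-invariant expectations on a FIXED finite torus T⁴ — NOT infinite volume, NOT a mass gap, NOT the Clay problem.  The spine
estimate NE9 (`T4OutputRate.NE9`) is NOT PRINTED in the audited series and is NOT PROVED here.  This module is real arithmetic
about the SCALAR binders of the landed END faces at the corrected history channel `T := 𝒯 ∘ P`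
(`NE9MarginalProjectionEnd.ne9_and_fadingMemory_of_couplingTwoPoint_vacSub_sizeInduction_compProj` / `…_margProj`, rate
`ω + 8·lipbar·B·((1 + c)·τ̄)`, `c = cr·a`) — over ABSTRACT letters.  No `def … : Prop` is minted (trigger c3: N2 stays a displayed
binder); nothing printed is asserted; the locators below say only which printed sentence a HYPOTHESIS SHAPE types.  Spine estimates
PROVED: 0/9, unchanged; leaves instantiated on Bałaban's objects: 0/18, unchanged.  HONEST DEPENDENCY (cell, verbatim): continuum YM
on T⁴ ⇐ BetaPertH ∧ nine spine estimates (0/9 proved); BetaPertH ⇐ (D1) ∧ (D4) ∧ CAP+tail; G-an2-4 gates asym, D1 and NE2/3/4.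

WHAT THE RIDER IS (skeleton v1.3.1 §3 row N2).  The per-creation-step gain `L^jη` of [Balaban1988RG2Cluster] p. 8 l. 9–10 (the
source of the fading profile `τ k j ≤ τ̄·ω^{k−j}`) is, by the mechanism of [Balaban1987RG1] p. 258 (0.28)–(0.29), a property of
MARGINAL-FREE inputs; the frame's history channel is therefore `𝒯 ∘ P`, `P H = H − r(H)·A` the read-out projection, with per-step
weight `(1 + c)·τ`, `c = cr·a` (`NE9MarginalProjection.channelSizeAtStepNN_compProj`, `projSize_margProj`): `cr` = node U2's
read-out constant (binder `ReadSize`; `T4BetaReadOutLipschitz.readBoundedOn_recipe`: `cr = 8K/α²` for probe recipes — printed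
STRUCTURE [Balaban1987RG1] (1.20)–(1.22) p. 264, (4.3)–(4.5) pp. 281–282; the NUMBER is NOT PRINTED, cell GAPS C-ne4p1-7), `a` =
the size of the marginal direction (binder `DirSize`: the one-cube Wilson action on the complex domains `U^c_j(X, α₀, α₁)` of
(1.11)–(1.14) p. 262 — elementary, with the model O1, not typed today).  Every (w6) lemma is stated for an ARBITRARY real `K`, so
the rider is the substitution `K ↦ K·(1 + c)` (§1 `rate_marg_eq`), made explicit so that consumers and the census cite `c`.

## What is PROVED (kernel; Mathlib + the two imports; no `sorry`, no new axiom, 0 `def`)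

§1 THE REGION with the factor [folklore]: `rate_marg_eq` (`ω + K·l·B·((1+c)·t) = ω + (K·(1+c))·l·B·t`), `fade_marg_iff_prod_lt`,
`rate_marg_mono` (monotone in `c`), `rate_le_rate_marg` / `fade_of_fade_marg` (`c ≥ 0`: the rider only RAISES the rate, so
(w6)'s fading is NECESSARY), `fade_marg_iff_cost_lt` (a CEILING ON THE PROJECTION COST `1 + c < (1 − ω)/(K·l·B·t)`),
`fade_marg_iff_budget_lt`, `fade_marg_iff_eps_lt` + `eps_threshold_marg` (ONE letter linear in ε₁ — the located dictionary of the
(w6) census: the ε₁-threshold is DIVIDED by `1 + c`; «cr, a ε₁-free ⇒ the ε₁-region only rescales», row owner), `rate_marg_pos`.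
§2 THE PRINTED LETTERS with the factor [hypothesis SHAPES only]: `rateGap_marg_le_of_printed` (`≤ 648·K(1+c)·c₁c₂/M⁴`, E₀
cancels, no ε₁), `fade_marg_of_printed`, `room_marg_iff` (the (w6) room divided by `1 + c`); THE M⁴-READING of the skeleton's
gloss «cr·a = O(M⁴(α₀+α₁)²·K/α²)» (v1.3.1 §1), `c = C·M⁴`: `rateGap_marg_le_of_printed_M4` (`≤ 648Kc₁c₂/M⁴ + 648Kc₁c₂·C` — an
M-FREE term), `fade_marg_of_printed_M4`, `printedBound_M4_ge_one` (if `648Kc₁c₂·C ≥ 1 − 1/L` the p. 20/p. 21 BOUND is ≥ 1 for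
EVERY M: under that reading «M sufficiently large» alone no longer closes the inequality — the bound fails, not the rate); THE
p. 18 ROUTE with the factor: `rateGap_marg_le_of_p18` (budget `B ≤ c_B·2(L+2)⁴c′e^{−5κ}` = the output shape of (w6)'s
`budget_le_of_p18` ⟹ gap `≤ 2592·K(1+c)·c₁c₂c′c_B·(L+2)⁴e^{−5κ}/(E₀M⁴)`), `fade_marg_of_p18`, `fade_marg_of_p18_M4_uniform`
(`c = C·M⁴`, `M ≥ 1`: fading ⟸ `2592K(1+C)c⋆⋆(L+2)⁴e^{−5κ} < (1 − 1/L)E₀` — TYPE «κ sufficiently large», UNIFORM in M;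
[Balaban1987RG1] Thm 3 p. 264: «κ ≥ κ₀, M ≥ M(κ) … The constants ε₀, ε₁, α₀, α₁ depend on M»).
§3 THE FLOOR OF THE FACTOR [folklore, on `NE9MarginalProjection`'s binders]: `one_le_readConst_mul_dirSize` — `ReadSize`,
`DirSize`, the scale-j slice of `A` admissible and the read-out NORMALISED on it (`r j (A↾j) = 1`: the recipe returns the
coefficient of the marginal direction — the content of `ProjInto` for `margProj r A`) ⟹ `1 ≤ cr·a`.  Hence `rate_twoK_le_rate_marg`
/ `fade_twoK_of_fade_marg` / `room_marg_le_half`: the (w6) tables are to be re-read at `K_eff = K(1+c) ≥ 2K` (16 on END-V).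
§4 JUNCTION BY NAME with the owner's anchors: `anchor_smallness_of_printed` (`NE9MarginalProjection.rate_lt_one_of_smallness`
fed from the printed letters), `anchor_letters_of_printed` (`rate_lt_one_letters`, ω = L⁻¹, L ≥ 2); their thresholds (gain
≤ (1 − ω)/2, resp. ≤ 1/4) are cruder than §2's exact room `1 − 1/L`.
§5 CONSUMER SIDE by name at the rider rate: an `example` — `historyBracket_le_of_geometricStep` verbatim.
§6 NUMERIC CORNERS (`norm_num`; no letter of Bałaban's is valued): floor `c = 1`, K = 8 (K_eff = 16), L = M = 13: room
`c₁c₂ < 2197/864 ≈ 2.54` ((w6) at K = 8: 5.09), `c₁c₂ = 2` fades, `3` does not; M⁴-reading at K = 8, c₁c₂ = 1, L = 13: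
critical M-free constant `C† = 1/5616 ≈ 1.78·10⁻⁴`, `C = 2·10⁻⁴` gives a bound ≥ 1 for every M.  Census sheet with every
locator and the two-engine tables (incl. M = L² = 169): `HOME/t4/b2b-balaban-t4-ne9-formalise-leaf-07/NE9FadingCensusRider.md`.

NOT COVERED.  The SIZE of `c = cr·a` on Bałaban's objects (rows RO/AW, GATED on O1: (w8)/(w9)) — whether `c` is M-free or carries
M⁴ is NOT decidable from print (cr NOT PRINTED) and is left OPEN here (both readings served: §2); instantiating any letter on
Bałaban's objects (row O1, carver) — 0/18 today.  Provenance: NE9 swarm seat leaf-07 (gen 2), 2026-08-20.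
-/

namespace Summit.QuantumFields.BalabanUV.T4Continuum.NE9FadingArithmeticRider

open Literature.MathematicalPhysics.QuantumFieldTheory.Balaban1983to89
open Literature.MathematicalPhysics.QuantumFieldTheory.Balaban1983to89.T4OutputRate
open Literature.MathematicalPhysics.QuantumFieldTheory.Balaban1983to89.T4HistoryLipschitzRecursion
open Summit.QuantumFields.BalabanUV.T4Continuum.NE9FadingArithmetic
open Summit.QuantumFields.BalabanUV.T4Continuum.NE9MarginalProjection

/-! ## §1 The region of `ω + K·l·B·((1 + c)·t) < 1` -/

section Region

/-- THE RIDER IS A RESCALED `K`: `ω + K·l·B·((1+c)·t) = ω + (K·(1+c))·l·B·t` — every (w6) lemma (stated for arbitrary real `K`)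
applies with `K ↦ K·(1+c)`. [folklore] -/
theorem rate_marg_eq (ω K l B t c : ℝ) : ω + K * l * B * ((1 + c) * t) = ω + K * (1 + c) * l * B * t := by
  ring

/-- The fading condition with the factor as a ceiling on the PRODUCT of the three letters:
`ω + K·l·B·((1+c)·t) < 1 ↔ l·B·t < (1 − ω)/(K·(1+c))` (`K > 0`, `c ≥ 0`). [folklore] -/
theorem fade_marg_iff_prod_lt {ω K l B t c : ℝ} (hK : 0 < K) (hc : 0 ≤ c) :
    ω + K * l * B * ((1 + c) * t) < 1 ↔ l * B * t < (1 - ω) / (K * (1 + c)) := by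
  rw [rate_marg_eq]
  exact fade_iff_prod_lt (by positivity)

/-- The rider rate is MONOTONE in the projection cost `c` (letters nonnegative). [folklore] -/
theorem rate_marg_mono {ω K l B t c c' : ℝ} (hK : 0 ≤ K) (hl : 0 ≤ l) (hB : 0 ≤ B) (ht : 0 ≤ t) (hcc : c ≤ c') :
    ω + K * l * B * ((1 + c) * t) ≤ ω + K * l * B * ((1 + c') * t) := by
  have h0 : 0 ≤ K * l * B := by positivity
  have h1 : (1 + c) * t ≤ (1 + c') * t := mul_le_mul_of_nonneg_right (by linarith) ht
  have h2 : K * l * B * ((1 + c) * t) ≤ K * l * B * ((1 + c') * t) := mul_le_mul_of_nonneg_left h1 h0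
  linarith

/-- The rider only RAISES the rate: `ω + K·l·B·t ≤ ω + K·l·B·((1+c)·t)` for `c ≥ 0`. [folklore] -/
theorem rate_le_rate_marg {ω K l B t c : ℝ} (hK : 0 ≤ K) (hl : 0 ≤ l) (hB : 0 ≤ B) (ht : 0 ≤ t) (hc : 0 ≤ c) :
    ω + K * l * B * t ≤ ω + K * l * B * ((1 + c) * t) :=
  calc ω + K * l * B * t = ω + K * l * B * ((1 + 0) * t) := by ring
    _ ≤ ω + K * l * B * ((1 + c) * t) := rate_marg_mono hK hl hB ht hc

/-- Hence the (w6) fading condition is NECESSARY for fading under the rider. [folklore] -/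
theorem fade_of_fade_marg {ω K l B t c : ℝ} (hK : 0 ≤ K) (hl : 0 ≤ l) (hB : 0 ≤ B) (ht : 0 ≤ t) (hc : 0 ≤ c)
    (h : ω + K * l * B * ((1 + c) * t) < 1) : ω + K * l * B * t < 1 :=
  (rate_le_rate_marg hK hl hB ht hc).trans_lt h

/-- The fading condition as a CEILING ON THE PROJECTION COST at fixed (w6) letters:
`ω + K·l·B·((1+c)·t) < 1 ↔ 1 + c < (1 − ω)/(K·l·B·t)` (`K, l, B, t > 0`). [folklore] -/
theorem fade_marg_iff_cost_lt {ω K l B t c : ℝ} (hK : 0 < K) (hl : 0 < l) (hB : 0 < B) (ht : 0 < t) :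
    ω + K * l * B * ((1 + c) * t) < 1 ↔ 1 + c < (1 - ω) / (K * l * B * t) := by
  rw [lt_div_iff₀ (by positivity), show K * l * B * ((1 + c) * t) = (1 + c) * (K * l * B * t) by ring]
  constructor <;> intro h <;> linarith

/-- The fading condition with the factor as a CEILING ON THE NEW-TERM BUDGET `B`:
`… ↔ B < (1 − ω)/(K·l·((1+c)·t))` — (w6)'s `fade_iff_budget_lt` at the weight `(1+c)·t`. [folklore] -/
theorem fade_marg_iff_budget_lt {ω K l B t c : ℝ} (hK : 0 < K) (hl : 0 < l) (ht : 0 < t) (hc : 0 ≤ c) :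
    ω + K * l * B * ((1 + c) * t) < 1 ↔ B < (1 - ω) / (K * l * ((1 + c) * t)) :=
  fade_iff_budget_lt hK hl (by positivity)

/-- ONE letter linear in a small parameter (`B = b·ε`, the located dictionary of the (w6) census: `B` ↔ the (2.41) budget
`O(1)C₃ε₁`, `cr` and `a` ε₁-free): `… ↔ ε < (1 − ω)/(K·l·b·((1+c)·t))`. [folklore] -/
theorem fade_marg_iff_eps_lt {ω K l b t c ε : ℝ} (hK : 0 < K) (hl : 0 < l) (hb : 0 < b) (ht : 0 < t) (hc : 0 ≤ c) :
    ω + K * l * (b * ε) * ((1 + c) * t) < 1 ↔ ε < (1 - ω) / (K * l * b * ((1 + c) * t)) :=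
  fade_iff_eps_lt hK hl hb (by positivity)

/-- «THE ε₁-REGION ONLY RESCALES»: the ε-threshold with the factor is the (w6) threshold DIVIDED by `1 + c`. [folklore] -/
theorem eps_threshold_marg (ω K l b t c : ℝ) :
    (1 - ω) / (K * l * b * ((1 + c) * t)) = (1 - ω) / (K * l * b * t) / (1 + c) := by
  rw [div_div]
  congr 1
  ring

/-- The END's positivity binder `hpos` at the rider rate from the sign of the letters (`ω > 0`). [folklore] -/
theorem rate_marg_pos {ω K l B t c : ℝ} (hω : 0 < ω) (hK : 0 ≤ K) (hl : 0 ≤ l) (hB : 0 ≤ B) (ht : 0 ≤ t) (hc : 0 ≤ c) :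
    0 < ω + K * l * B * ((1 + c) * t) := by
  have : 0 ≤ K * l * B * ((1 + c) * t) := by positivity
  linarith

end Region

/-! ## §2 The printed letters with the factor: the gap `K·lipbar·B·((1 + c)·τ̄)` under the located standing assumptions -/

section Printed

/-- **THE GAP WITH THE FACTOR IN PRINT'S LETTERS.**  With `lipbar = c₁·α₄/E₀`, `τ̄ = c₂·(6L)⁴` and the two located standing
assumptions typed as hypotheses — `(L·M)⁴·α₄ ≤ 1` (p. 20) and `B ≤ E₀/2` (p. 21) — the gap obeys
`K·lipbar·B·((1+c)·τ̄) ≤ 648·K(1+c)·c₁c₂/M⁴` ((w6)'s `rateGap_le_of_printed` at `K ↦ K(1+c)`; E₀ cancels, no ε₁ survives).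
Hypothesis shapes only; nothing of [II] asserted. [cite: Balaban1988RG2Cluster, p.8, (1.36) p.9, (2.18)-(2.20) p.16, p.20, (2.41) p.21] -/
theorem rateGap_marg_le_of_printed {K L M α₄ E₀ B c₁ c₂ c : ℝ} (hK : 0 ≤ K) (hc : 0 ≤ c) (hM : 0 < M) (hE : 0 < E₀)
    (hB : 0 ≤ B) (hc₁ : 0 ≤ c₁) (hc₂ : 0 ≤ c₂) (h20 : (L * M) ^ 4 * α₄ ≤ 1) (h21 : B ≤ E₀ / 2) :
    K * (c₁ * α₄ / E₀) * B * ((1 + c) * (c₂ * (6 * L) ^ 4)) ≤ 648 * (K * (1 + c)) * (c₁ * c₂) / M ^ 4 := by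
  have h := rateGap_le_of_printed (K := K * (1 + c)) (L := L) (α₄ := α₄) (by positivity) hM hE hB hc₁ hc₂ h20 h21
  calc K * (c₁ * α₄ / E₀) * B * ((1 + c) * (c₂ * (6 * L) ^ 4))
      = K * (1 + c) * (c₁ * α₄ / E₀) * B * (c₂ * (6 * L) ^ 4) := by ring
    _ ≤ 648 * (K * (1 + c)) * (c₁ * c₂) / M ^ 4 := h

/-- **FADING WITH THE FACTOR FROM THE PRINTED STANDING ASSUMPTIONS, modulo the clause `648·K(1+c)·c₁c₂ < (1 − 1/L)·M⁴`**
(of the printed TYPE «M sufficiently large» WHEN `c` is M-free — see `printedBound_M4_ge_one` for the other reading).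
Hypothesis shapes only. [cite: Balaban1988RG2Cluster, p.20, p.21; Balaban1987RG1, Thm 3 p.264] -/
theorem fade_marg_of_printed {K L M α₄ E₀ B c₁ c₂ c : ℝ} (hK : 0 ≤ K) (hc : 0 ≤ c) (hM : 0 < M) (hE : 0 < E₀)
    (hB : 0 ≤ B) (hc₁ : 0 ≤ c₁) (hc₂ : 0 ≤ c₂) (h20 : (L * M) ^ 4 * α₄ ≤ 1) (h21 : B ≤ E₀ / 2)
    (hroom : 648 * (K * (1 + c)) * (c₁ * c₂) < (1 - 1 / L) * M ^ 4) :
    1 / L + K * (c₁ * α₄ / E₀) * B * ((1 + c) * (c₂ * (6 * L) ^ 4)) < 1 := by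
  have h := fade_of_printed (K := K * (1 + c)) (L := L) (α₄ := α₄) (by positivity) hM hE hB hc₁ hc₂ h20 h21 hroom
  calc 1 / L + K * (c₁ * α₄ / E₀) * B * ((1 + c) * (c₂ * (6 * L) ^ 4))
      = 1 / L + K * (1 + c) * (c₁ * α₄ / E₀) * B * (c₂ * (6 * L) ^ 4) := by ring
    _ < 1 := h

/-- The room for the product `c⋆ = c₁c₂` is the (w6) room `R(L, M, K) = (1 − 1/L)M⁴/(648K)` DIVIDED by `1 + c`. [folklore] -/
theorem room_marg_iff {K L M cstar c : ℝ} (hK : 0 < K) (hc : 0 ≤ c) :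
    648 * (K * (1 + c)) * cstar < (1 - 1 / L) * M ^ 4 ↔ cstar < (1 - 1 / L) * M ^ 4 / (648 * K) / (1 + c) := by
  rw [div_div, lt_div_iff₀ (by positivity), show 648 * (K * (1 + c)) * cstar = cstar * (648 * K * (1 + c)) by ring]

/-- **THE M⁴-READING** of the skeleton's gloss «`cr·a = O(M⁴(α₀+α₁)²·K/α²)`» (v1.3.1 §1), `c = C·M⁴` with `C ≥ 0` M-free: the
printed-letters bound acquires an M-FREE term, `gap ≤ 648Kc₁c₂/M⁴ + 648Kc₁c₂·C`.  Hypothesis shapes only; which reading of `c`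
holds is NOT decidable from print (cr NOT PRINTED, cell GAPS C-ne4p1-7). [cite: Balaban1988RG2Cluster, p.20, p.21] -/
theorem rateGap_marg_le_of_printed_M4 {K L M α₄ E₀ B c₁ c₂ C : ℝ} (hK : 0 ≤ K) (hC : 0 ≤ C) (hM : 0 < M) (hE : 0 < E₀)
    (hB : 0 ≤ B) (hc₁ : 0 ≤ c₁) (hc₂ : 0 ≤ c₂) (h20 : (L * M) ^ 4 * α₄ ≤ 1) (h21 : B ≤ E₀ / 2) :
    K * (c₁ * α₄ / E₀) * B * ((1 + C * M ^ 4) * (c₂ * (6 * L) ^ 4)) ≤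
      648 * K * (c₁ * c₂) / M ^ 4 + 648 * K * (c₁ * c₂) * C := by
  have h := rateGap_marg_le_of_printed hK (c := C * M ^ 4) (by positivity) hM hE hB hc₁ hc₂ h20 h21
  have hM4 : M ^ 4 ≠ 0 := by positivity
  have heq : 648 * (K * (1 + C * M ^ 4)) * (c₁ * c₂) / M ^ 4 = 648 * K * (c₁ * c₂) / M ^ 4 + 648 * K * (c₁ * c₂) * C := by
    field_simp
  linarith

/-- Fading under the M⁴-reading: `648Kc₁c₂·(1/M⁴ + C) < 1 − 1/L` suffices. [cite: Balaban1988RG2Cluster, p.20, p.21] -/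
theorem fade_marg_of_printed_M4 {K L M α₄ E₀ B c₁ c₂ C : ℝ} (hK : 0 ≤ K) (hC : 0 ≤ C) (hM : 0 < M) (hE : 0 < E₀)
    (hB : 0 ≤ B) (hc₁ : 0 ≤ c₁) (hc₂ : 0 ≤ c₂) (h20 : (L * M) ^ 4 * α₄ ≤ 1) (h21 : B ≤ E₀ / 2)
    (hroom : 648 * K * (c₁ * c₂) * (1 / M ^ 4 + C) < 1 - 1 / L) :
    1 / L + K * (c₁ * α₄ / E₀) * B * ((1 + C * M ^ 4) * (c₂ * (6 * L) ^ 4)) < 1 := by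
  have h := rateGap_marg_le_of_printed_M4 hK hC hM hE hB hc₁ hc₂ h20 h21 (L := L)
  have heq : 648 * K * (c₁ * c₂) * (1 / M ^ 4 + C) = 648 * K * (c₁ * c₂) / M ^ 4 + 648 * K * (c₁ * c₂) * C := by ring
  linarith

/-- **UNDER THE M⁴-READING «M SUFFICIENTLY LARGE» ALONE NO LONGER CLOSES THE INEQUALITY**: if the M-free term already exceeds the
margin, `1 − 1/L ≤ 648Kc₁c₂·C`, then the printed-letters BOUND of the rate is `≥ 1` for EVERY `M > 0` (the bound fails, not the
rate — nothing is claimed about the rate itself). [folklore] -/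
theorem printedBound_M4_ge_one {K L M c₁ c₂ C : ℝ} (hK : 0 ≤ K) (hM : 0 < M) (hc₁ : 0 ≤ c₁) (hc₂ : 0 ≤ c₂)
    (hbig : 1 - 1 / L ≤ 648 * K * (c₁ * c₂) * C) :
    1 ≤ 1 / L + (648 * K * (c₁ * c₂) / M ^ 4 + 648 * K * (c₁ * c₂) * C) := by
  have : 0 ≤ 648 * K * (c₁ * c₂) / M ^ 4 := by positivity
  linarith

/-- **THE p. 18 ROUTE WITH THE FACTOR.**  With `lipbar = c₁·α₄/E₀`, `τ̄ = c₂·(6L)⁴`, the standing assumption `(L·M)⁴·α₄ ≤ 1`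
(p. 20) and the budget in its ε₁-EXPLICIT form `B ≤ c_B·(2(L+2)⁴·c′·e^{−5κ})` — the output shape of (w6)'s `budget_le_of_p18`
(C₃'s printed DEFINITION p. 20 + the p. 18 standing assumption «2E₀ε₁C₁α₄⁻¹α₆⁻¹M^q exp C₂κ₁ exp 5κ ≤ 1») times the (N)-profile's
O(1) `c_B` — the gap obeys `≤ 2592·K(1+c)·c₁c₂c′c_B·(L+2)⁴·e^{−5κ}/(E₀M⁴)`.  Hypothesis shapes only.
[cite: Balaban1988RG2Cluster, p.18, p.20, (2.41) p.21] -/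
theorem rateGap_marg_le_of_p18 {K L M α₄ E₀ B c₁ c₂ c cB c' κ : ℝ} (hK : 0 ≤ K) (hc : 0 ≤ c) (hM : 0 < M) (hE : 0 < E₀)
    (hB : 0 ≤ B) (hc₁ : 0 ≤ c₁) (hc₂ : 0 ≤ c₂) (h20 : (L * M) ^ 4 * α₄ ≤ 1)
    (hB18 : B ≤ cB * (2 * (L + 2) ^ 4 * c' * Real.exp (-(5 * κ)))) :
    K * (c₁ * α₄ / E₀) * B * ((1 + c) * (c₂ * (6 * L) ^ 4)) ≤
      2592 * (K * (1 + c)) * (c₁ * c₂ * c' * cB) * (L + 2) ^ 4 * Real.exp (-(5 * κ)) / (E₀ * M ^ 4) := by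
  have hM4 : 0 < M ^ 4 := by positivity
  have h1 : L ^ 4 * α₄ ≤ 1 / M ^ 4 := by
    rw [le_div_iff₀ hM4]
    calc L ^ 4 * α₄ * M ^ 4 = (L * M) ^ 4 * α₄ := by ring
      _ ≤ 1 := h20
  have h2 : B / E₀ ≤ cB * (2 * (L + 2) ^ 4 * c' * Real.exp (-(5 * κ))) / E₀ :=
    div_le_div_of_nonneg_right hB18 hE.le
  have hBE : 0 ≤ B / E₀ := div_nonneg hB hE.le
  calc K * (c₁ * α₄ / E₀) * B * ((1 + c) * (c₂ * (6 * L) ^ 4))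
      = 1296 * (K * (1 + c)) * (c₁ * c₂) * (L ^ 4 * α₄) * (B / E₀) := by ring
    _ ≤ 1296 * (K * (1 + c)) * (c₁ * c₂) * (1 / M ^ 4) * (cB * (2 * (L + 2) ^ 4 * c' * Real.exp (-(5 * κ))) / E₀) := by
        gcongr
    _ = 2592 * (K * (1 + c)) * (c₁ * c₂ * c' * cB) * (L + 2) ^ 4 * Real.exp (-(5 * κ)) / (E₀ * M ^ 4) := by
        field_simp
        ring

/-- **FADING ON THE p. 18 ROUTE WITH THE FACTOR**, modulo the clause `2592·K(1+c)·c⋆⋆·(L+2)⁴·e^{−5κ} < (1 − 1/L)·E₀·M⁴`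
(`c⋆⋆ = c₁c₂c′c_B`) — of the printed TYPE «κ sufficiently large» ([II] p. 18 «For κ sufficiently large and α₆ sufficiently
small»). Hypothesis shapes only. [cite: Balaban1988RG2Cluster, p.18, p.20] -/
theorem fade_marg_of_p18 {K L M α₄ E₀ B c₁ c₂ c cB c' κ : ℝ} (hK : 0 ≤ K) (hc : 0 ≤ c) (hM : 0 < M) (hE : 0 < E₀)
    (hB : 0 ≤ B) (hc₁ : 0 ≤ c₁) (hc₂ : 0 ≤ c₂) (h20 : (L * M) ^ 4 * α₄ ≤ 1)
    (hB18 : B ≤ cB * (2 * (L + 2) ^ 4 * c' * Real.exp (-(5 * κ))))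
    (hroom : 2592 * (K * (1 + c)) * (c₁ * c₂ * c' * cB) * (L + 2) ^ 4 * Real.exp (-(5 * κ)) < (1 - 1 / L) * (E₀ * M ^ 4)) :
    1 / L + K * (c₁ * α₄ / E₀) * B * ((1 + c) * (c₂ * (6 * L) ^ 4)) < 1 := by
  have h := rateGap_marg_le_of_p18 hK hc hM hE hB hc₁ hc₂ h20 hB18
  have hpos : 0 < E₀ * M ^ 4 := by positivity
  have h' : 2592 * (K * (1 + c)) * (c₁ * c₂ * c' * cB) * (L + 2) ^ 4 * Real.exp (-(5 * κ)) / (E₀ * M ^ 4) < 1 - 1 / L := by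
    rw [div_lt_iff₀ hpos]
    exact hroom
  linarith

/-- **THE p. 18 ROUTE UNDER THE M⁴-READING IS UNIFORM IN M**: with `c = C·M⁴` and `M ≥ 1`, the clause
`2592·K·(1 + C)·c⋆⋆·(L+2)⁴·e^{−5κ} < (1 − 1/L)·E₀` (M-FREE, TYPE «κ sufficiently large»; [I] Thm 3 p. 264 chooses `κ ≥ κ₀` BEFORE
`M ≥ M(κ)`) gives fading for every such M.  Hypothesis shapes only. [cite: Balaban1988RG2Cluster, p.18, p.20; Balaban1987RG1, Thm 3 p.264] -/
theorem fade_marg_of_p18_M4_uniform {K L M α₄ E₀ B c₁ c₂ C cB c' κ : ℝ} (hK : 0 ≤ K) (hC : 0 ≤ C) (hM : 1 ≤ M)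
    (hE : 0 < E₀) (hB : 0 ≤ B) (hc₁ : 0 ≤ c₁) (hc₂ : 0 ≤ c₂) (hcB : 0 ≤ cB) (hc' : 0 ≤ c') (h20 : (L * M) ^ 4 * α₄ ≤ 1)
    (hB18 : B ≤ cB * (2 * (L + 2) ^ 4 * c' * Real.exp (-(5 * κ))))
    (hroom : 2592 * (K * (1 + C)) * (c₁ * c₂ * c' * cB) * (L + 2) ^ 4 * Real.exp (-(5 * κ)) < (1 - 1 / L) * E₀) :
    1 / L + K * (c₁ * α₄ / E₀) * B * ((1 + C * M ^ 4) * (c₂ * (6 * L) ^ 4)) < 1 := by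
  have hM0 : 0 < M := by linarith
  have hM4 : 1 ≤ M ^ 4 := one_le_pow₀ hM
  have hM4pos : 0 < M ^ 4 := by positivity
  have h := rateGap_marg_le_of_p18 hK (c := C * M ^ 4) (by positivity) hM0 hE hB hc₁ hc₂ h20 hB18
  -- the bound divided by M⁴: (1 + C M⁴)/M⁴ ≤ 1 + C for M ≥ 1
  have hX : 0 ≤ 2592 * K * (c₁ * c₂ * c' * cB) * (L + 2) ^ 4 * Real.exp (-(5 * κ)) / E₀ := by positivity
  have hfrac : (1 + C * M ^ 4) / M ^ 4 ≤ 1 + C := by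
    rw [div_le_iff₀ hM4pos]
    nlinarith
  have hrew : 2592 * (K * (1 + C * M ^ 4)) * (c₁ * c₂ * c' * cB) * (L + 2) ^ 4 * Real.exp (-(5 * κ)) / (E₀ * M ^ 4) =
      2592 * K * (c₁ * c₂ * c' * cB) * (L + 2) ^ 4 * Real.exp (-(5 * κ)) / E₀ * ((1 + C * M ^ 4) / M ^ 4) := by
    field_simp
  have hbound : 2592 * (K * (1 + C * M ^ 4)) * (c₁ * c₂ * c' * cB) * (L + 2) ^ 4 * Real.exp (-(5 * κ)) / (E₀ * M ^ 4) ≤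
      2592 * K * (c₁ * c₂ * c' * cB) * (L + 2) ^ 4 * Real.exp (-(5 * κ)) / E₀ * (1 + C) := by
    rw [hrew]
    exact mul_le_mul_of_nonneg_left hfrac hX
  have hroom' : 2592 * K * (c₁ * c₂ * c' * cB) * (L + 2) ^ 4 * Real.exp (-(5 * κ)) / E₀ * (1 + C) < 1 - 1 / L := by
    rw [div_mul_eq_mul_div, div_lt_iff₀ hE]
    calc 2592 * K * (c₁ * c₂ * c' * cB) * (L + 2) ^ 4 * Real.exp (-(5 * κ)) * (1 + C)
        = 2592 * (K * (1 + C)) * (c₁ * c₂ * c' * cB) * (L + 2) ^ 4 * Real.exp (-(5 * κ)) := by ring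
      _ < (1 - 1 / L) * E₀ := hroom
  linarith

end Printed

/-! ## §3 The floor of the factor: `cr·a ≥ 1` on `NE9MarginalProjection`'s binders -/

section Floor

variable {C : Carriers} {Bg : Type}

/-- **THE FACTOR IS AT LEAST 2.**  If the read-out is `cr`-bounded on the admissible class (`ReadSize`, node U2's (R)), the
marginal direction has size `a` (`DirSize`), its scale-`j` slice is admissible, and the read-out is NORMALISED on it —
`r j (A↾j) = 1`: the recipe (1.20)–(1.22) returns the coefficient of the marginal direction, which is what makes `margProj r A`
land in the marginal-free class (`ProjInto`) — then `1 ≤ cr·a`.  Bookkeeping on displayed binders; nothing printed asserted.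
[cite: Balaban1987RG1, (1.3) p.260, (1.18) p.263, (1.20)-(1.22) p.264] -/
theorem one_le_readConst_mul_dirSize {Adm : Set (Bg → C.Dom → ℝ)} {r : ℕ → (Bg → C.Dom → ℝ) → ℝ} {A : Bg → C.Dom → ℝ}
    {κ cr a : ℝ} (hrs : ReadSize Adm r κ cr) (hA : DirSize A κ a) (ha : 0 ≤ a) {j : ℕ}
    (hAj : restrictScale j A ∈ Adm) (hnorm : r j (restrictScale j A) = 1) : 1 ≤ cr * a := by
  have hb : ∀ (U : Bg) (X : C.Dom), C.scale X = j → |restrictScale j A U X| ≤ Real.exp (-(κ * C.d X)) * a := by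
    intro U X hX
    rw [restrictScale_of_eq A hX, mul_comm]
    exact hA U X
  have h := hrs j (restrictScale j A) hAj a ha hb
  rw [restrictScale_restrictScale_self, hnorm, abs_one] at h
  exact h

/-- Under the floor `c ≥ 1` the rider rate DOMINATES the (w6) rate read at `2K` (letters nonnegative). [folklore] -/
theorem rate_twoK_le_rate_marg {ω K l B t c : ℝ} (hK : 0 ≤ K) (hl : 0 ≤ l) (hB : 0 ≤ B) (ht : 0 ≤ t) (hc : 1 ≤ c) :
    ω + 2 * K * l * B * t ≤ ω + K * l * B * ((1 + c) * t) := by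
  have h0 : 0 ≤ K * l * B * t := by positivity
  have h1 : 2 * (K * l * B * t) ≤ (1 + c) * (K * l * B * t) := mul_le_mul_of_nonneg_right (by linarith) h0
  calc ω + 2 * K * l * B * t = ω + 2 * (K * l * B * t) := by ring
    _ ≤ ω + (1 + c) * (K * l * B * t) := by linarith
    _ = ω + K * l * B * ((1 + c) * t) := by ring

/-- **NECESSARY UNDER THE RIDER**: if the corrected rate fades then the (w6) product read at `2K` (= 16 on the vacuum-subtracted
faces) fades — the (w6) tables are to be re-read at `K_eff = K(1+c) ≥ 2K`. [folklore] -/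
theorem fade_twoK_of_fade_marg {ω K l B t c : ℝ} (hK : 0 ≤ K) (hl : 0 ≤ l) (hB : 0 ≤ B) (ht : 0 ≤ t) (hc : 1 ≤ c)
    (h : ω + K * l * B * ((1 + c) * t) < 1) : ω + 2 * K * l * B * t < 1 :=
  (rate_twoK_le_rate_marg hK hl hB ht hc).trans_lt h

/-- With the floor, the printed-letters room for `c⋆ = c₁c₂` is AT MOST HALF the (w6) room. [folklore] -/
theorem room_marg_le_half {K L M c : ℝ} (hK : 0 < K) (hc : 1 ≤ c) (hLM : 0 ≤ (1 - 1 / L) * M ^ 4) :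
    (1 - 1 / L) * M ^ 4 / (648 * K) / (1 + c) ≤ (1 - 1 / L) * M ^ 4 / (648 * K) / 2 := by
  have hR : 0 ≤ (1 - 1 / L) * M ^ 4 / (648 * K) := div_nonneg hLM (by positivity)
  exact div_le_div_of_nonneg_left hR two_pos (by linarith)

end Floor

/-! ## §4 Junction BY NAME with the owner's kernel anchors (`NE9MarginalProjection` §4) -/

section Anchors

/-- `NE9MarginalProjection.rate_lt_one_of_smallness` FED FROM THE PRINTED LETTERS: if `648·K(1+c)·c₁c₂/M⁴ ≤ (1 − ω)/2` (K = 8)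
then the corrected rate fades — the anchor's threshold (gain ≤ half the margin) is cruder than §2's exact room. Hypothesis
shapes only. [cite: Balaban1988RG2Cluster, (1.36) p.9, p.20, p.21] -/
theorem anchor_smallness_of_printed {ω L M α₄ E₀ B c₁ c₂ c : ℝ} (hω : ω < 1) (hc : 0 ≤ c) (hM : 0 < M) (hE : 0 < E₀)
    (hB : 0 ≤ B) (hc₁ : 0 ≤ c₁) (hc₂ : 0 ≤ c₂) (h20 : (L * M) ^ 4 * α₄ ≤ 1) (h21 : B ≤ E₀ / 2)
    (hhalf : 648 * (8 * (1 + c)) * (c₁ * c₂) / M ^ 4 ≤ (1 - ω) / 2) :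
    ω + 8 * (c₁ * α₄ / E₀) * B * ((1 + c) * (c₂ * (6 * L) ^ 4)) < 1 :=
  rate_lt_one_of_smallness hω
    ((rateGap_marg_le_of_printed (K := 8) (by norm_num) hc hM hE hB hc₁ hc₂ h20 h21).trans hhalf)

/-- `NE9MarginalProjection.rate_lt_one_letters` (ω = L⁻¹, L ≥ 2) FED FROM THE PRINTED LETTERS: if `648·8(1+c)·c₁c₂/M⁴ ≤ 1/4`
then `1/L + gap < 1`.  Hypothesis shapes only. [cite: Balaban1988RG2Cluster, p.8 l.9-10, p.20, p.21] -/
theorem anchor_letters_of_printed {L M α₄ E₀ B c₁ c₂ c : ℝ} (hL : 2 ≤ L) (hc : 0 ≤ c) (hM : 0 < M) (hE : 0 < E₀)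
    (hB : 0 ≤ B) (hc₁ : 0 ≤ c₁) (hc₂ : 0 ≤ c₂) (h20 : (L * M) ^ 4 * α₄ ≤ 1) (h21 : B ≤ E₀ / 2)
    (hquarter : 648 * (8 * (1 + c)) * (c₁ * c₂) / M ^ 4 ≤ 1 / 4) :
    1 / L + 8 * (c₁ * α₄ / E₀) * B * ((1 + c) * (c₂ * (6 * L) ^ 4)) < 1 :=
  rate_lt_one_letters hL
    ((rateGap_marg_le_of_printed (K := 8) (by norm_num) hc hM hE hB hc₁ hc₂ h20 h21).trans hquarter)

end Anchors

/-! ## §5 Consumer side, by name: the history bracket at the rider rate under fading -/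

section Consumer

/-- On the marginal-projection faces (rate `ω + 8·lipbar·B·((1+c)·τ̄)`, amplitude `ℓ = 8·clipbar·B + 8·lipbar·B·qTbar`): under
fading the node-U3 history bracket is bounded UNIFORMLY in the creation step — P2's `historyBracket_le_of_geometricStep`
verbatim. [folklore] -/
example {clipbar qTbar lipbar B τbar ω c D : ℝ} (hℓ : 0 ≤ 8 * clipbar * B + 8 * lipbar * B * qTbar)
    (hpos : 0 < ω + 8 * lipbar * B * ((1 + c) * τbar)) (hfade : ω + 8 * lipbar * B * ((1 + c) * τbar) < 1)
    {gA gB : ℕ → ℝ} (hD : ∀ i, |gA i - gB i| ≤ D) (j : ℕ) :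
    ∑ i ∈ Finset.range j,
        prodModuli (8 * clipbar * B + 8 * lipbar * B * qTbar) (fun _ => ω + 8 * lipbar * B * ((1 + c) * τbar)) j i *
          |gA i - gB i| ≤
      (8 * clipbar * B + 8 * lipbar * B * qTbar) / (ω + 8 * lipbar * B * ((1 + c) * τbar)) * D *
        (1 - (ω + 8 * lipbar * B * ((1 + c) * τbar)))⁻¹ :=
  historyBracket_le_of_geometricStep hℓ hpos hfade hD j

end Consumer

/-! ## §6 Numeric corners (no letter of Bałaban's is valued; two external engines reproduce the tables, census sheet) -/

section Numeric

/-- FLOOR c = 1, K = 8 (K_eff = 16), L = M = 13: the room is `c₁c₂ < 2197/864` (≈ 2.54; (w6) at K = 8: 2197/432 ≈ 5.09). [folklore] -/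
example : (1 - 1 / 13) * (13 : ℝ) ^ 4 / (648 * 8) / (1 + 1) = 2197 / 864 := by norm_num

/-- At L = M = 13, K_eff = 16 the product `c₁c₂ = 2` fades (`1/13 + 10368·2/13⁴ = 22933/28561 < 1`) … [folklore] -/
example : (1 : ℝ) / 13 + 648 * (8 * (1 + 1)) * 2 / 13 ^ 4 < 1 := by norm_num

/-- … and `c₁c₂ = 3` does not (`33301/28561 > 1`), where (w6) at K = 8 still had room up to 5.09. [folklore] -/
example : ¬ ((1 : ℝ) / 13 + 648 * (8 * (1 + 1)) * 3 / 13 ^ 4 < 1) := by norm_num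

/-- M⁴-READING, K = 8, c₁c₂ = 1, L = 13: the critical M-free constant is `C† = (12/13)/5184 = 1/5616` (≈ 1.78·10⁻⁴). [folklore] -/
example : (1 - 1 / 13 : ℝ) / (648 * 8 * 1) = 1 / 5616 := by norm_num

/-- `C = 2·10⁻⁴ > C†`: the bound is `≥ 1` for EVERY M > 0 (`printedBound_M4_ge_one`; `C = 10⁻⁴ < C†` fades at M = 13, census
sheet Table E). [folklore] -/
example {M : ℝ} (hM : 0 < M) : 1 ≤ 1 / 13 + (648 * 8 * (1 * 1) / M ^ 4 + 648 * 8 * (1 * 1) * (2 / 10000 : ℝ)) :=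
  printedBound_M4_ge_one (K := 8) (L := 13) (c₁ := 1) (c₂ := 1) (by norm_num) hM (by norm_num) (by norm_num) (by norm_num)

/-- `fade_marg_of_printed` fires on the corner L = M = 13, K = 8, c = 1, c₁ = c₂ = 1 (`10368 < (12/13)·28561 ≈ 26364`) for ANY
admissible α₄ (of either sign), E₀, B. [folklore] -/
example {α₄ E₀ B : ℝ} (hE : 0 < E₀) (hB : 0 ≤ B) (h20 : (13 * 13 : ℝ) ^ 4 * α₄ ≤ 1) (h21 : B ≤ E₀ / 2) :
    1 / 13 + 8 * (1 * α₄ / E₀) * B * ((1 + 1) * (1 * (6 * 13) ^ 4)) < 1 :=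
  fade_marg_of_printed (K := 8) (L := 13) (M := 13) (c := 1) (by norm_num) (by norm_num) (by norm_num) hE hB (by norm_num)
    (by norm_num) h20 h21 (by norm_num)

end Numeric

end Summit.QuantumFields.BalabanUV.T4Continuum.NE9FadingArithmeticRider
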